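import Summits.Ventures.DiscreteObjects.UnitDistance.MoserHermitianColouring
import Summits.Ventures.DiscreteObjects.UnitDistance.MoserLocalData
import Mathlib.Analysis.InnerProductSpace.PiL2
import Summits.Ventures.DiscreteObjects.UnitDistance.SixChromatic
import Summits.Ventures.DiscreteObjects.UnitDistance.UnitCircleGraph
import Literature.Combinatorics.SimpleGraph.MoserMoser1961.MoserSpindle

/-!
# THEOREM U1 in the kernel: `χ(ℚ(√3,√11)²) = 4` (cell `pub-namedobj`, target (U), seat udg g10)

Framing (verbatim for the cell): lottery ticket; floor = certified bounds/negative ranges.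

Every unit-distance graph all of whose vertices have both coordinates in the real field `K = ℚ(√3, √11)` (the field
generated by the Moser spindle) is `4`-colourable; with the Moser spindle, `χ(K²) = 4`.  This is THEOREM U1 of the
cell (udg g2, `MOSER-FIELD.md` 2026-08-20; referee verify-ref g25 §8; lead gen 4; PARI third check), now a
hypothesis-free kernel theorem: it sharpens Madore 2015 (arXiv:1509.07023) Prop. 4.5 (`4 ≤ χ(K²) ≤ 5`) and answers
the in-field question of Exoo–Ismailescu 2018 (arXiv:1805.00157, p. 8) in the negative — no 5-chromatic unit-distance
graph has all its vertices in `ℚ(√3,√11)²`; the known 5-chromatic constructions (de Grey, Heule, Parts) must leave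
the field.  Prior art for the in-RING half (graphs on the Moser ring `ℤ[ω₁, ω₃, 1/3]`): Hubai 2018 (Polymath16),
Dúcz arXiv:2606.12325 Thm 3.1–3.2, kernel `colorable_four_of_moserRing` (p215439); the field-plane extension is the
2-adic valuation step formalised in `SpectralUnitBall` → `TwoAdicSquares` → `MoserLocalReduction` →
`MoserHermitianColouring` → `MoserLocalData` → this file: the spectral norm on `\overline{ℚ₂}` makes every unit step
`u = (x−x') + i(y−y')` a unit (`u·σu = 1`, Galois invariance), and its residue a cube root of unity (via the second
Galois element `τ`), so residues of centred vertex labels `4`-colour the graph.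

Main statements: `colorable_four_of_moserCoordField` (any graph with `K`-coordinates and unit-quadrance edges),
`colorable_four_of_realisation_in_moserCoordField` (unit-distance realisations in the plane),
`chromaticNumber_unitCircleGraph_moserCoordField : χ(unitCircleGraph K) = 4`,
`chromaticNumber_plane_moserCoordField : χ(planeUnitDistanceGraph.induce K²) = 4`.
Standard axioms only; zero compute.  The THEOREM is the cell's (novelty PROVISIONAL per FRESHNESS F-U); the
formalisation route (spectral norm instead of prime decomposition) is this seat's.
-/

noncomputable section

namespace Summit.Ventures.DiscreteObjects.UnitDistance

open MoserLocal SimpleGraph Literature.Combinatorics.SimpleGraph.MoserMoser1961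
open scoped IntermediateField

/-- GENERAL REDUCTION THEOREM.  Let `K ⊆ ℝ` be a subfield with a ring homomorphism `φ : K → Ω₂` whose image lies
in `ℚ₂(s3)` for some local data `D`.  Then every graph with `K`-coordinates and unit-quadrance edges is `4`-colourable
(labels `z v = φ(x v) + I·φ(y v)` have unit-step differences; `MoserHermitianColouring`). -/
theorem colorable_four_of_embedding (K : IntermediateField ℚ ℝ) (D : LocalData Ω₂) (φ : K →+* Ω₂)
    (hφ : ∀ t, φ t ∈ ℚ_[2]⟮D.s3⟯) {V : Type*} {G : SimpleGraph V} (x y : V → K)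
    (hadj : ∀ ⦃v w : V⦄, G.Adj v w → (x v - x w) ^ 2 + (y v - y w) ^ 2 = 1) : G.Colorable 4 := by
  let z : V → Ω₂ := fun v => φ (x v) + D.I * φ (y v)
  apply colorable_four_of_unitStep_labels D z
  intro v w hvw
  have h3 : D.s3 ^ 2 = algebraMap ℚ_[2] Ω₂ 3 := by rw [D.hs3, map_ofNat]
  obtain ⟨a, b, hab⟩ := exists_coeffs_of_mem_adjoin_simple h3 (hφ (x v - x w))
  obtain ⟨c, d, hcd⟩ := exists_coeffs_of_mem_adjoin_simple h3 (hφ (y v - y w))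
  refine ⟨a, b, c, d, ?_, ?_⟩
  · change (φ (x v) + D.I * φ (y v)) - (φ (x w) + D.I * φ (y w)) = _
    rw [← hab, ← hcd, map_sub, map_sub]; ring
  · rw [← hab, ← hcd, ← map_pow, ← map_pow, ← map_add, hadj hvw, map_one]

/-- THEOREM U1 (core form).  A graph whose vertices carry coordinates `x v, y v ∈ K = ℚ(√3,√11)` with
`(x v − x w)² + (y v − y w)² = 1` along every edge is `4`-colourable. -/
theorem colorable_four_of_moserCoordField {V : Type*} {G : SimpleGraph V} (x y : V → moserCoordField)
    (hadj : ∀ ⦃v w : V⦄, G.Adj v w → (x v - x w) ^ 2 + (y v - y w) ^ 2 = 1) : G.Colorable 4 :=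
  colorable_four_of_embedding moserCoordField localData₂ (moserEmbed : moserCoordField →ₐ[ℚ] Ω₂).toRingHom
    (fun t => moserEmbed_mem localData₂ t) x y hadj

/-- THEOREM U1, real-coordinate form: vertices placed in `ℝ²` with all coordinates in `ℚ(√3,√11)` and adjacent
vertices at (squared) distance `1` ⇒ `4`-colourable. -/
theorem colorable_four_of_real_coords {V : Type*} {G : SimpleGraph V} (x y : V → ℝ)
    (hx : ∀ v, x v ∈ moserCoordField) (hy : ∀ v, y v ∈ moserCoordField)
    (hadj : ∀ ⦃v w : V⦄, G.Adj v w → (x v - x w) ^ 2 + (y v - y w) ^ 2 = 1) : G.Colorable 4 := by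
  refine colorable_four_of_moserCoordField (fun v => ⟨x v, hx v⟩) (fun v => ⟨y v, hy v⟩) ?_
  intro v w hvw
  apply Subtype.ext
  push_cast
  exact hadj hvw

/-- Squared-coordinate form of `dist p q = 1` in the Euclidean plane. -/
theorem sq_add_sq_eq_one_of_dist_eq_one {p q : EuclideanSpace ℝ (Fin 2)} (h : dist p q = 1) :
    (p 0 - q 0) ^ 2 + (p 1 - q 1) ^ 2 = 1 := by
  have h2 := EuclideanSpace.dist_sq_eq p q
  rw [h, one_pow, Fin.sum_univ_two, Real.dist_eq, Real.dist_eq, sq_abs, sq_abs] at h2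
  exact h2.symm

/-- THEOREM U1 for unit-distance realisations (answers Exoo–Ismailescu 2018, p. 8): a graph with an (injective)
unit-distance realisation in the plane all of whose coordinates lie in `ℚ(√3, √11)` is `4`-colourable. -/
theorem colorable_four_of_realisation_in_moserCoordField {V : Type*} {G : SimpleGraph V}
    {p : V → EuclideanSpace ℝ (Fin 2)} (hp : IsUnitDistanceRealisation G p)
    (hK : ∀ v i, p v i ∈ moserCoordField) : G.Colorable 4 :=
  colorable_four_of_real_coords (fun v => p v 0) (fun v => p v 1) (fun v => hK v 0) (fun v => hK v 1)
    fun _ _ hvw => sq_add_sq_eq_one_of_dist_eq_one (hp.2 hvw)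

/-- COROLLARY (the negative answer to the in-field question): there is NO unit-distance graph realised with all
coordinates in `ℚ(√3, √11)` that fails to be `4`-colourable — every 5-chromatic unit-distance graph leaves the field. -/
theorem not_exists_fiveChromatic_in_moserCoordField :
    ¬ ∃ (V : Type) (G : SimpleGraph V) (p : V → EuclideanSpace ℝ (Fin 2)),
      IsUnitDistanceRealisation G p ∧ (∀ v i, p v i ∈ moserCoordField) ∧ ¬ G.Colorable 4 := by
  rintro ⟨V, G, p, hp, hK, h4⟩
  exact h4 (colorable_four_of_realisation_in_moserCoordField hp hK)

/-! ## The lower bound: the Moser spindle lives in `ℚ(√3, √11)²` -/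

/-- The fourteen coordinates of the Moser spindle (`MoserSpindle.pt`, Heule 2018 §2.1) lie in `ℚ(√3, √11)`. -/
theorem pt_mem_moserCoordField (i : Fin 7) : (pt i).1 ∈ moserCoordField ∧ (pt i).2 ∈ moserCoordField := by
  fin_cases i
  · refine ⟨?_, ?_⟩
    · convert combo_mem 0 0 0 0 using 1; simp [pt]
    · convert combo_mem 0 0 0 0 using 1; simp [pt]
  · refine ⟨?_, ?_⟩
    · convert combo_mem 1 0 0 0 using 1; simp [pt]
    · convert combo_mem 0 0 0 0 using 1; simp [pt]
  · refine ⟨?_, ?_⟩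
    · convert combo_mem (1/2) 0 0 0 using 1; simp [pt]
    · convert combo_mem 0 (1/2) 0 0 using 1; simp [pt]; ring
  · refine ⟨?_, ?_⟩
    · convert combo_mem (3/2) 0 0 0 using 1; simp [pt]
    · convert combo_mem 0 (1/2) 0 0 using 1; simp [pt]; ring
  · refine ⟨?_, ?_⟩
    · convert combo_mem (5/6) 0 0 0 using 1; simp [pt]
    · convert combo_mem 0 0 (1/6) 0 using 1; simp [pt]; ring
  · refine ⟨?_, ?_⟩
    · convert combo_mem (5/12) 0 0 (-1/12) using 1; simp [pt]; ring
    · convert combo_mem 0 (5/12) (1/12) 0 using 1; simp [pt]; ring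
  · refine ⟨?_, ?_⟩
    · convert combo_mem (5/4) 0 0 (-1/12) using 1; simp [pt]; ring
    · convert combo_mem 0 (5/12) (1/4) 0 using 1; simp [pt]; ring

/-- The Moser spindle with `K`-valued coordinates. -/
def spindleK (i : Fin 7) : moserCoordField × moserCoordField :=
  (⟨(pt i).1, (pt_mem_moserCoordField i).1⟩, ⟨(pt i).2, (pt_mem_moserCoordField i).2⟩)

/-- The Moser spindle maps homomorphically into `unitCircleGraph K`. -/
def spindleHomK : moserSpindle →g unitCircleGraph moserCoordField where
  toFun := spindleK
  map_rel' := by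
    intro i j hij
    have hsq : ((spindleK i).1 - (spindleK j).1) ^ 2 + ((spindleK i).2 - (spindleK j).2) ^ 2 = 1 := by
      apply Subtype.ext
      push_cast
      have := adj_sqDist_eq_one hij
      simpa [sqDist, spindleK] using this
    exact ⟨ne_of_sq_add_sq_eq_one hsq, hsq⟩

/-- `unitCircleGraph K` is not `3`-colourable (it contains the Moser spindle). -/
theorem not_colorable_three_unitCircleGraph_moserCoordField : ¬ (unitCircleGraph moserCoordField).Colorable 3 :=
  fun h => not_colorable_three (h.of_hom spindleHomK)

/-- `unitCircleGraph K` is `4`-colourable (THEOREM U1). -/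
theorem colorable_four_unitCircleGraph_moserCoordField : (unitCircleGraph moserCoordField).Colorable 4 :=
  colorable_four_of_moserCoordField (G := unitCircleGraph moserCoordField) Prod.fst Prod.snd
    fun _ _ h => h.2

/-- THEOREM U1 (algebraic form): `χ(ℚ(√3,√11)²) = 4`, i.e. the unit-quadrance graph of the field `K = ℚ(√3,√11)`
has chromatic number exactly `4`. -/
theorem chromaticNumber_unitCircleGraph_moserCoordField :
    (unitCircleGraph moserCoordField).chromaticNumber = 4 := by
  rw [show (4 : ℕ∞) = (3 : ℕ) + 1 by norm_num]
  exact chromaticNumber_eq_iff_colorable_not_colorable.mpr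
    ⟨colorable_four_unitCircleGraph_moserCoordField, not_colorable_three_unitCircleGraph_moserCoordField⟩

/-! ## Plane form: the induced subgraph of `planeUnitDistanceGraph` on `ℚ(√3,√11)²` -/

/-- The points of the Euclidean plane with both coordinates in `ℚ(√3, √11)`. -/
def moserFieldPoints : Set (EuclideanSpace ℝ (Fin 2)) := {q | ∀ i, q i ∈ moserCoordField}

/-- The unit-distance graph of the plane restricted to `ℚ(√3,√11)²` is `4`-colourable. -/
theorem colorable_four_plane_moserCoordField : (planeUnitDistanceGraph.induce moserFieldPoints).Colorable 4 :=
  colorable_four_of_real_coords (G := planeUnitDistanceGraph.induce moserFieldPoints)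
    (fun q => (q : EuclideanSpace ℝ (Fin 2)) 0) (fun q => (q : EuclideanSpace ℝ (Fin 2)) 1)
    (fun q => q.2 0) (fun q => q.2 1) fun _ _ h => sq_add_sq_eq_one_of_dist_eq_one h

/-- The Moser spindle as points of `ℚ(√3,√11)² ⊂ ℝ²`. -/
def spindlePlane (i : Fin 7) : moserFieldPoints :=
  ⟨!₂[(pt i).1, (pt i).2], fun j => by
    fin_cases j
    · exact (pt_mem_moserCoordField i).1
    · exact (pt_mem_moserCoordField i).2⟩

/-- The Moser spindle maps homomorphically into the plane graph restricted to `ℚ(√3,√11)²`. -/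
def spindleHomPlane : moserSpindle →g planeUnitDistanceGraph.induce moserFieldPoints where
  toFun := spindlePlane
  map_rel' := by
    intro i j hij
    have hsq : sqDist (pt i) (pt j) = 1 := adj_sqDist_eq_one hij
    change dist (!₂[(pt i).1, (pt i).2] : EuclideanSpace ℝ (Fin 2)) !₂[(pt j).1, (pt j).2] = 1
    have hd : dist (!₂[(pt i).1, (pt i).2] : EuclideanSpace ℝ (Fin 2)) !₂[(pt j).1, (pt j).2] ^ 2 = 1 := by
      rw [EuclideanSpace.dist_sq_eq, Fin.sum_univ_two, Real.dist_eq, Real.dist_eq, sq_abs, sq_abs]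
      simpa [sqDist] using hsq
    exact (pow_eq_one_iff_of_nonneg dist_nonneg two_ne_zero).1 hd

/-- The plane graph restricted to `ℚ(√3,√11)²` is not `3`-colourable. -/
theorem not_colorable_three_plane_moserCoordField :
    ¬ (planeUnitDistanceGraph.induce moserFieldPoints).Colorable 3 :=
  fun h => not_colorable_three (h.of_hom spindleHomPlane)

/-- THEOREM U1 (plane form): the chromatic number of the Euclidean unit-distance graph restricted to the points of
`ℚ(√3,√11)²` is exactly `4` (`4 ≤ ·` Moser spindle; `· ≤ 4` the 2-adic Hermitian reduction). -/
theorem chromaticNumber_plane_moserCoordField :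
    (planeUnitDistanceGraph.induce moserFieldPoints).chromaticNumber = 4 := by
  rw [show (4 : ℕ∞) = (3 : ℕ) + 1 by norm_num]
  exact chromaticNumber_eq_iff_colorable_not_colorable.mpr
    ⟨colorable_four_plane_moserCoordField, not_colorable_three_plane_moserCoordField⟩

end Summit.Ventures.DiscreteObjects.UnitDistance
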